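import Summits.QuantumFields.GaugeBoot.ZdSchwingerDyson
import Summits.QuantumFields.GaugeBoot.PeriodicLoopEquationPairForm
import HarnessLib

/-!
# The single-link loop equation of a Haar-shift state on `ℤ^d`: abstract form, schema and real pair form (gauge-boot, `ℤ^d` loop equations 3/4)

HONEST FRAMING (cell `pub-gaugeboot`, page 1 of every file): the venture produces certified bounds
on lattice expectations at stated coupling, gauge group, dimension and torus size; NOT a mass gap,
NOT a continuum limit, NOT a string tension; NOT Yang–Mills-summit-bearing (barriers
`FixedCouplingUltralocality`, `PerturbativeInvisibility`).

File 3/4 of "Haar-shift identity ⇒ loop equations" on the infinite lattice `ℤ^d`: the `ℤ^d`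
analogues of `PeriodicLoopEquation.lean` (abstract loop equation from the pair identities),
`PeriodicLoopEquationSchema.lean` (occurrence sets decided on `ℤ^d`) and the representation-general
part of `PeriodicLoopEquationPairForm.lean`, for an ARBITRARY finite measure `μ` on `LGConfig d G` in
place of the Wilson measure of a finite periodic lattice. Two simplifications are specific to `ℤ^d`:
`castE zdUnit = id`, so EVERY word is small (`smallFor_zdUnit`: returns to the base point are read off
the integer displacements exactly, no size hypothesis), and the expectation is `∫ … ∂μ` for the given
state. Contents:

* `loopEquationZd_of_sdPair` — `Σ_k E_μ[splitTerm_k] + (β/2)·Σ_{ν≠a} Σ_{ε=±} E_μ[plaqTerm_{ν,ε}] = 0`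
  for a word closed at `x`, the link `(x, a)` and a weight `s` such that every contraction
  `X_ij = E_ij − (s/N)δ_ij` satisfies the pair identity `SDPairZd μ` (file 2/4);
* `loopEquationZd_schema` — the same with the split terms sorted into the forward / backward
  occurrence sets `fwdOccZ` / `bwdOccZ` of `LoopEquationSchema.lean`;
* `loopEquationZd_pairForm` — the REAL PAIR NORMAL FORM (variables `w(C) = (1/N) Re E_μ[tr ρ(hol_x C)]`,
  `d(A, B) = Re E_μ[tr ρ(hol_x A) tr ρ(hol_x B)]/N²` written out), any lattice representation `r`
  satisfying the pair identities — verbatim the shape of `TiltedRP.loopEquation_pairForm`.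

File 4/4 specialises to `SU(N)` / `U(N)` Haar-shift states, Class-B states and Class-T states in the
`wordHolonomyZd` vocabulary of `ClassBWords.lean`. Everything is `[folklore]`: the finite-`N`
single-link Schwinger–Dyson equations in normalised pair form (Anderson–Kruczenski Nucl. Phys. B 921
(2017) §2.2; Kazakov–Zheng JHEP 03 (2025) 099 §2.3 (2.26)–(2.31); Guo–Li–Yang–Zhu arXiv:2502.14421
§4), here for DLR / Haar-shift states of the infinite lattice (Chatterjee, Comm. Math. Phys. 366
(2019) Thm. 8.1 derives them for infinite-volume limits of `SO(N)` theory).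
-/

noncomputable section

open MeasureTheory
open scoped Matrix
open Literature.Probability.LatticeModels (Site)
open Literature.MathematicalPhysics.QuantumLattice (LGConfig ZdEdge)
open Literature.MathematicalPhysics.QuantumFieldTheory (LatticeRep)

namespace Summit.QuantumFields.GaugeBoot

namespace TiltedRP

variable {d : ℕ}

/-! ### Every word is small for `(ℤ^d, zdUnit)` -/

section Small

/-- `castE zdUnit` is the identity of `ℤ^d`. [folklore] -/
@[simp] theorem castE_zdUnit (v : Fin d → ℤ) : castE (zdUnit d) v = v := by
  ext i
  simp only [castE_apply, zdUnit_apply, Finset.sum_apply, Pi.smul_apply, Pi.single_apply, smul_eq_mul,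
    mul_ite, mul_one, mul_zero]
  rw [Finset.sum_ite_eq]
  simp

/-- **Every word is small for `(ℤ^d, zdUnit)`**: returns to the base point and to `x + e_μ` are read
off the integer displacements exactly. [folklore] -/
theorem smallFor_zdUnit (w : Word d) : Word.SmallFor (zdUnit d) w := fun k =>
  ⟨fun h => by rwa [castE_zdUnit] at h, fun μ h => by rwa [castE_zdUnit, zdUnit_apply] at h⟩

end Small

variable {G : Type} [Group G] [TopologicalSpace G] [IsTopologicalGroup G] [CompactSpace G]
  [MeasurableSpace G] [BorelSpace G] (μW : Measure (LGConfig d G)) [IsFiniteMeasure μW] (r : LatticeRep G)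

/-! ### The abstract loop equation -/

section Assembly

/-- **THE SINGLE-LINK LOOP EQUATION OF A STATE ON `ℤ^d` (abstract form).** Let `G` be compact with
lattice representation `r`, `μ` a finite measure on `LGConfig d G`, `β` real, `(x, a)` a link, `w` a word
CLOSED at `x`, and `s ∈ ℂ` a weight such that every direction `X_ij = E_ij − (s/N)δ_ij·1` satisfies the
pair identity `SDPairZd μ` at `(x, a)`. Then `Σ_k E[splitTerm_k] + (β/2)·Σ_{ν≠a} Σ_{ε=±} E[plaqTerm_{ν,ε}] = 0`,
`E` the expectation in `μ`. [folklore] -/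
theorem loopEquationZd_of_sdPair (β : ℝ) (x : Site d) (a : Fin d) (s : ℂ) (w : Word d)
    (hw : Word.endpoint (zdUnit d) x w = x)
    (hP : ∀ i j : Fin r.N, SDPairZd μW r β x a x w (unitDir s i j)) :
    (∑ k ∈ Finset.range w.length, ∫ U, splitTerm r.ρ (zdUnit d) s x a U w k ∂μW) +
      (β / 2 : ℂ) * ∑ ν ∈ Finset.univ.erase a, ∑ ε : Bool,
        ∫ U, plaqTerm r.ρ (zdUnit d) s x a U w ν ε ∂μW = 0 := by
  have hf : ∀ i j : Fin r.N, Integrable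
      (fun U => (Matrix.single j i (1 : ℂ) * insDeriv r.ρ (zdUnit d) (x, a) (unitDir s i j) U x w).trace)
      μW :=
    fun i j => integrable_of_continuous_zd r μW (continuous_trace_mul_insDeriv r (zdUnit d) _ _ (x, a) x w)
  have hg : ∀ i j : Fin r.N, Integrable (fun U => (Matrix.single j i (1 : ℂ) *
      r.ρ (wordHolonomy (zdUnit d) U x w)).trace *
        (-(1 / 2) * plaqIns r.ρ (zdUnit d) (unitDir s i j) U x a)) μW :=
    fun i j => integrable_of_continuous_zd r μW (continuous_rhsIntegrand r (zdUnit d) _ _ x a x w)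
  have h1 : ∫ U, ∑ k ∈ Finset.range w.length, splitTerm r.ρ (zdUnit d) s x a U w k ∂μW =
      (β : ℂ) * ∫ U, -(1 / 2) * ∑ ν ∈ Finset.univ.erase a, ∑ ε : Bool,
        plaqTerm r.ρ (zdUnit d) s x a U w ν ε ∂μW := by
    calc ∫ U, ∑ k ∈ Finset.range w.length, splitTerm r.ρ (zdUnit d) s x a U w k ∂μW
        = ∫ U, ∑ i : Fin r.N, ∑ j : Fin r.N, (Matrix.single j i (1 : ℂ) *
            insDeriv r.ρ (zdUnit d) (x, a) (unitDir s i j) U x w).trace ∂μW :=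
          integral_congr_ae (ae_of_all _ fun U => (sum_trace_insDeriv_unitDir (zdUnit d) s x a U w).symm)
      _ = ∑ i : Fin r.N, ∑ j : Fin r.N, ∫ U, (Matrix.single j i (1 : ℂ) *
            insDeriv r.ρ (zdUnit d) (x, a) (unitDir s i j) U x w).trace ∂μW := by
          rw [integral_finsetSum _ fun i _ => integrable_finsetSum _ fun j _ => hf i j]
          exact Finset.sum_congr rfl fun i _ => integral_finsetSum _ fun j _ => hf i j
      _ = ∑ i : Fin r.N, ∑ j : Fin r.N, (β : ℂ) *
            ∫ U, (Matrix.single j i (1 : ℂ) * r.ρ (wordHolonomy (zdUnit d) U x w)).trace *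
              (-(1 / 2) * plaqIns r.ρ (zdUnit d) (unitDir s i j) U x a) ∂μW :=
          Finset.sum_congr rfl fun i _ => Finset.sum_congr rfl fun j _ => hP i j (Matrix.single j i 1)
      _ = (β : ℂ) * ∑ i : Fin r.N, ∑ j : Fin r.N,
            ∫ U, (Matrix.single j i (1 : ℂ) * r.ρ (wordHolonomy (zdUnit d) U x w)).trace *
              (-(1 / 2) * plaqIns r.ρ (zdUnit d) (unitDir s i j) U x a) ∂μW := by
          simp only [Finset.mul_sum]
      _ = (β : ℂ) * ∫ U, ∑ i : Fin r.N, ∑ j : Fin r.N,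
            (Matrix.single j i (1 : ℂ) * r.ρ (wordHolonomy (zdUnit d) U x w)).trace *
              (-(1 / 2) * plaqIns r.ρ (zdUnit d) (unitDir s i j) U x a) ∂μW := by
          rw [integral_finsetSum _ fun i _ => integrable_finsetSum _ fun j _ => hg i j]
          congr 1
          exact (Finset.sum_congr rfl fun i _ => integral_finsetSum _ fun j _ => hg i j).symm
      _ = (β : ℂ) * ∫ U, -(1 / 2) * ∑ ν ∈ Finset.univ.erase a, ∑ ε : Bool,
            plaqTerm r.ρ (zdUnit d) s x a U w ν ε ∂μW := by
          congr 1
          exact integral_congr_ae (ae_of_all _ fun U =>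
            sum_trace_mul_plaqIns_unitDir (zdUnit d) s x a U w hw)
  have h2 : ∫ U, ∑ k ∈ Finset.range w.length, splitTerm r.ρ (zdUnit d) s x a U w k ∂μW =
      ∑ k ∈ Finset.range w.length, ∫ U, splitTerm r.ρ (zdUnit d) s x a U w k ∂μW :=
    integral_finsetSum _ fun k _ =>
      integrable_of_continuous_zd r μW (continuous_splitTerm (zdUnit d) r s x a w k)
  have h3 : ∫ U, -(1 / 2) * ∑ ν ∈ Finset.univ.erase a, ∑ ε : Bool,
        plaqTerm r.ρ (zdUnit d) s x a U w ν ε ∂μW =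
      -(1 / 2) * ∑ ν ∈ Finset.univ.erase a, ∑ ε : Bool,
        ∫ U, plaqTerm r.ρ (zdUnit d) s x a U w ν ε ∂μW := by
    rw [integral_const_mul]
    congr 1
    rw [integral_finsetSum _ fun ν _ => integrable_finsetSum _ fun ε _ =>
      integrable_of_continuous_zd r μW (continuous_plaqTerm (zdUnit d) r s x a w ν ε)]
    exact Finset.sum_congr rfl fun ν _ => integral_finsetSum _ fun ε _ =>
      integrable_of_continuous_zd r μW (continuous_plaqTerm (zdUnit d) r s x a w ν ε)
  rw [← h2, h1, h3]
  ring

/-- **THE LOOP-EQUATION SCHEMA of a state on `ℤ^d`.** For a word `w` closed at `x`, the single-link loop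
equation at `(x, a)` reads
`Σ_{k : fwdOccZ} E[tr A_k tr B_k − (s/N) tr W] − Σ_{k : bwdOccZ} E[tr A'_k tr B'_k − (s/N) tr W]
+ (β/2) Σ_{ν≠a,ε} E[plaqTerm_{ν,ε}] = 0`, the occurrence sets COMPUTED from the word on `ℤ^d` (every word
is small for `zdUnit`). [folklore] -/
theorem loopEquationZd_schema (β : ℝ) (x : Site d) (a : Fin d) (s : ℂ) (w : Word d)
    (hw : Word.endpoint (zdUnit d) x w = x)
    (hP : ∀ i j : Fin r.N, SDPairZd μW r β x a x w (unitDir s i j)) :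
    (∑ k ∈ (Finset.range w.length).filter (w.fwdOccZ a),
        ∫ U, ((r.ρ (wordHolonomy (zdUnit d) U x (w.take k))).trace *
            (r.ρ (wordHolonomy (zdUnit d) U (Word.siteAt (zdUnit d) x w k) (w.drop k))).trace -
          (s / r.N) * (r.ρ (wordHolonomy (zdUnit d) U x w)).trace) ∂μW) -
      (∑ k ∈ (Finset.range w.length).filter (w.bwdOccZ a),
        ∫ U, ((r.ρ (wordHolonomy (zdUnit d) U x (w.take (k + 1)))).trace *
            (r.ρ (wordHolonomy (zdUnit d) U (Word.siteAt (zdUnit d) x w (k + 1)) (w.drop (k + 1)))).trace -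
          (s / r.N) * (r.ρ (wordHolonomy (zdUnit d) U x w)).trace) ∂μW) +
      (β / 2 : ℂ) * ∑ ν ∈ Finset.univ.erase a, ∑ ε : Bool,
        ∫ U, plaqTerm r.ρ (zdUnit d) s x a U w ν ε ∂μW = 0 := by
  have h := loopEquationZd_of_sdPair μW r β x a s w hw hP
  have hsm := smallFor_zdUnit w
  have hsplit : ∀ k, ∫ U, splitTerm r.ρ (zdUnit d) s x a U w k ∂μW =
      (if w.fwdOccZ a k then
        ∫ U, ((r.ρ (wordHolonomy (zdUnit d) U x (w.take k))).trace *
            (r.ρ (wordHolonomy (zdUnit d) U (Word.siteAt (zdUnit d) x w k) (w.drop k))).trace -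
          (s / r.N) * (r.ρ (wordHolonomy (zdUnit d) U x w)).trace) ∂μW else 0) -
      (if w.bwdOccZ a k then
        ∫ U, ((r.ρ (wordHolonomy (zdUnit d) U x (w.take (k + 1)))).trace *
            (r.ρ (wordHolonomy (zdUnit d) U (Word.siteAt (zdUnit d) x w (k + 1)) (w.drop (k + 1)))).trace -
          (s / r.N) * (r.ρ (wordHolonomy (zdUnit d) U x w)).trace) ∂μW else 0) := by
    intro k
    rw [integral_congr_ae (ae_of_all _ fun U => splitTerm_eq_of_smallFor r.ρ (zdUnit d) hsm s x a U k)]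
    by_cases hf : w.fwdOccZ a k
    · have hb : ¬ w.bwdOccZ a k := fun hb => by
        have h1 := hf.1; have h2 := hb.1; rw [h1] at h2; simp at h2
      simp only [hf, hb, if_true, if_false, sub_zero]
    · by_cases hb : w.bwdOccZ a k
      · simp only [hf, hb, if_true, if_false, integral_neg, zero_sub]
      · simp only [hf, hb, if_false, integral_zero, sub_zero]
  simp_rw [hsplit, Finset.sum_sub_distrib, Finset.sum_ite, Finset.sum_const_zero, add_zero] at h
  exact h

end Assembly

/-! ### The real pair normal form -/

section PairForm

/-- `U ↦ tr ρ(hol_x(v)(U))` is integrable for every finite measure on `ℤ^d` configurations. [folklore] -/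
theorem integrable_trace_wordHolonomy_zd (x : Site d) (v : Word d) :
    Integrable (fun U : LGConfig d G => (r.ρ (wordHolonomy (zdUnit d) U x v)).trace) μW :=
  integrable_of_continuous_zd r μW (continuous_trace_wordHolonomy (zdUnit d) r x v)

/-- `U ↦ tr ρ(hol_x(u)) · tr ρ(hol_y(v))` is integrable for every finite measure on `ℤ^d`
configurations. [folklore] -/
theorem integrable_trace_mul_trace_zd (x y : Site d) (u v : Word d) :
    Integrable (fun U : LGConfig d G =>
      (r.ρ (wordHolonomy (zdUnit d) U x u)).trace * (r.ρ (wordHolonomy (zdUnit d) U y v)).trace) μW :=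
  integrable_of_continuous_zd r μW
    ((continuous_trace_wordHolonomy (zdUnit d) r x u).mul (continuous_trace_wordHolonomy (zdUnit d) r y v))

omit [IsTopologicalGroup G] [CompactSpace G] [BorelSpace G] [IsFiniteMeasure μW] in
/-- **The marked letter: `d([], C) = w(C)`** —
`Re E[tr ρ(hol []) · tr ρ(hol C)] / N² = (1/N) Re E[tr ρ(hol C)]`. [folklore] -/
theorem re_integral_trace_nil_mul_trace_zd (x : Site d) (v : Word d) :
    (∫ U, (r.ρ (wordHolonomy (zdUnit d) U x ([] : Word d))).trace *
        (r.ρ (wordHolonomy (zdUnit d) U x v)).trace ∂μW).re / (r.N : ℝ) ^ 2 =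
      (r.N : ℝ)⁻¹ * (∫ U, (r.ρ (wordHolonomy (zdUnit d) U x v)).trace ∂μW).re := by
  simp only [wordHolonomy_nil, map_one, Matrix.trace_one, Fintype.card_fin]
  rw [integral_const_mul, ← Complex.ofReal_natCast, Complex.re_ofReal_mul]
  by_cases hN : (r.N : ℝ) = 0
  · simp [hN]
  · field_simp

/-- **The split term, integrated**: for a prefix `w[0,k)` returning to `x`,
`∫ (tr A_k · tr B_k − (s/N) tr W) dμ = E[tr A_k · tr B_k] − (s/N)·E[tr W]`. [folklore] -/
theorem integral_splitTerm_zd (s : ℂ) (x : Site d) (w : Word d) {k : ℕ}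
    (hk : Word.siteAt (zdUnit d) x w k = x) :
    ∫ U, ((r.ρ (wordHolonomy (zdUnit d) U x (w.take k))).trace *
          (r.ρ (wordHolonomy (zdUnit d) U (Word.siteAt (zdUnit d) x w k) (w.drop k))).trace -
        s / r.N * (r.ρ (wordHolonomy (zdUnit d) U x w)).trace) ∂μW =
      (∫ U, (r.ρ (wordHolonomy (zdUnit d) U x (w.take k))).trace *
          (r.ρ (wordHolonomy (zdUnit d) U x (w.drop k))).trace ∂μW) -
        s / r.N * ∫ U, (r.ρ (wordHolonomy (zdUnit d) U x w)).trace ∂μW := by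
  rw [hk, integral_sub (integrable_trace_mul_trace_zd μW r x x _ _)
      ((integrable_trace_wordHolonomy_zd μW r x w).const_mul _), integral_const_mul]

/-- **The plaquette term, integrated.** [folklore] -/
theorem integral_plaqTerm_zd (s : ℂ) (x : Site d) (a : Fin d) (w : Word d) (ν : Fin d) (ε : Bool) :
    ∫ U, plaqTerm r.ρ (zdUnit d) s x a U w ν ε ∂μW =
      (∫ U, (r.ρ (wordHolonomy (zdUnit d) U x (w ++ plaqWord a ν ε))).trace ∂μW) -
        (∫ U, (r.ρ (wordHolonomy (zdUnit d) U x (w ++ (plaqWord a ν ε).reverse))).trace ∂μW) -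
        s / r.N * ((∫ U, (r.ρ (wordHolonomy (zdUnit d) U x w)).trace *
              (r.ρ (wordHolonomy (zdUnit d) U x (plaqWord a ν ε))).trace ∂μW) -
          (∫ U, (r.ρ (wordHolonomy (zdUnit d) U x w)).trace *
              (r.ρ (wordHolonomy (zdUnit d) U x (plaqWord a ν ε).reverse)).trace ∂μW)) := by
  have hA := integrable_trace_wordHolonomy_zd μW r x (w ++ plaqWord a ν ε)
  have hB := integrable_trace_wordHolonomy_zd μW r x (w ++ (plaqWord a ν ε).reverse)
  have hP := integrable_trace_mul_trace_zd μW r x x w (plaqWord a ν ε)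
  have hQ := integrable_trace_mul_trace_zd μW r x x w (plaqWord a ν ε).reverse
  have hAB : Integrable (fun U : LGConfig d G =>
      (r.ρ (wordHolonomy (zdUnit d) U x (w ++ plaqWord a ν ε))).trace -
        (r.ρ (wordHolonomy (zdUnit d) U x (w ++ (plaqWord a ν ε).reverse))).trace) μW :=
    hA.sub hB
  have hPQ : Integrable (fun U : LGConfig d G =>
      s / r.N * ((r.ρ (wordHolonomy (zdUnit d) U x w)).trace *
          (r.ρ (wordHolonomy (zdUnit d) U x (plaqWord a ν ε))).trace) -
        s / r.N * ((r.ρ (wordHolonomy (zdUnit d) U x w)).trace *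
          (r.ρ (wordHolonomy (zdUnit d) U x (plaqWord a ν ε).reverse)).trace)) μW :=
    (hP.const_mul _).sub (hQ.const_mul _)
  simp only [plaqTerm, mul_sub]
  rw [integral_sub hAB hPQ, integral_sub hA hB, integral_sub (hP.const_mul _) (hQ.const_mul _),
    integral_const_mul, integral_const_mul]

/-- **THE SINGLE-LINK LOOP EQUATION OF A STATE ON `ℤ^d` IN REAL PAIR NORMAL FORM (any lattice
representation).** For a finite measure `μ` on `LGConfig d G` and `r` satisfying the pair identities
`SDPairZd μ` at `(x, a)` for the contractions `unitDir s`, and a word `w` closed at `x`, with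
`w(C) = (1/N) Re E_μ[tr ρ(hol_x C)]` and `d(A, B) = Re E_μ[tr ρ(hol_x A) · tr ρ(hol_x B)] / N²` written out:
`Σ_{k ∈ fwdOccZ} (d(w[0,k), w[k,n)) − s·w(w)/N²) − Σ_{k ∈ bwdOccZ} (d(w[0,k], w(k,n)) − s·w(w)/N²)`
`+ (β/(2N))·Σ_{ν ≠ a} Σ_ε (w(w·P̃) − w(w·P̃⁻¹) − s·(d(w, P̃) − d(w, P̃⁻¹))) = 0`. [folklore] -/
theorem loopEquationZd_pairForm (β : ℝ) (x : Site d) (a : Fin d) (s : ℝ) (w : Word d)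
    (hw : Word.endpoint (zdUnit d) x w = x)
    (hP : ∀ i j : Fin r.N, SDPairZd μW r β x a x w (unitDir (s : ℂ) i j)) :
    (∑ k ∈ (Finset.range w.length).filter (w.fwdOccZ a),
        ((∫ U, (r.ρ (wordHolonomy (zdUnit d) U x (w.take k))).trace *
              (r.ρ (wordHolonomy (zdUnit d) U x (w.drop k))).trace ∂μW).re / (r.N : ℝ) ^ 2 -
          s * ((r.N : ℝ)⁻¹ * (∫ U, (r.ρ (wordHolonomy (zdUnit d) U x w)).trace ∂μW).re /
            (r.N : ℝ) ^ 2))) -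
      (∑ k ∈ (Finset.range w.length).filter (w.bwdOccZ a),
        ((∫ U, (r.ρ (wordHolonomy (zdUnit d) U x (w.take (k + 1)))).trace *
              (r.ρ (wordHolonomy (zdUnit d) U x (w.drop (k + 1)))).trace ∂μW).re / (r.N : ℝ) ^ 2 -
          s * ((r.N : ℝ)⁻¹ * (∫ U, (r.ρ (wordHolonomy (zdUnit d) U x w)).trace ∂μW).re /
            (r.N : ℝ) ^ 2))) +
      β / (2 * r.N) * ∑ ν ∈ Finset.univ.erase a, ∑ ε : Bool,
        ((r.N : ℝ)⁻¹ * (∫ U, (r.ρ (wordHolonomy (zdUnit d) U x (w ++ plaqWord a ν ε))).trace ∂μW).re -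
          (r.N : ℝ)⁻¹ * (∫ U, (r.ρ (wordHolonomy (zdUnit d) U x (w ++ (plaqWord a ν ε).reverse))).trace
            ∂μW).re -
          s * ((∫ U, (r.ρ (wordHolonomy (zdUnit d) U x w)).trace *
                (r.ρ (wordHolonomy (zdUnit d) U x (plaqWord a ν ε))).trace ∂μW).re / (r.N : ℝ) ^ 2 -
            (∫ U, (r.ρ (wordHolonomy (zdUnit d) U x w)).trace *
                (r.ρ (wordHolonomy (zdUnit d) U x (plaqWord a ν ε).reverse)).trace ∂μW).re /
              (r.N : ℝ) ^ 2)) = 0 := by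
  have h := loopEquationZd_schema μW r β x a (s : ℂ) w hw hP
  have hsm := smallFor_zdUnit w
  -- forward occurrences: the prefix `w[0,k)` is closed at `x`
  have hf : ∀ k ∈ (Finset.range w.length).filter (w.fwdOccZ a), Word.siteAt (zdUnit d) x w k = x :=
    fun k hk => (Word.siteAt_eq_iff_of_smallFor (zdUnit d) hsm x k).2 (Finset.mem_filter.1 hk).2.2
  -- backward occurrences: the prefix `w[0,k]` is closed at `x`
  have hb : ∀ k ∈ (Finset.range w.length).filter (w.bwdOccZ a),
      Word.siteAt (zdUnit d) x w (k + 1) = x := by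
    intro k hk
    obtain ⟨hk1, hk2⟩ := (Finset.mem_filter.1 hk).2
    refine (Word.siteAt_eq_iff_of_smallFor (zdUnit d) hsm x (k + 1)).2 ?_
    rw [GaugeBoot.Word.dispZ_succ_of_getElem? hk1, hk2]
    ext i
    by_cases hi : i = a
    · subst hi; simp [Step.dispZ]
    · simp [Step.dispZ, hi]
  rw [Finset.sum_congr rfl fun k hk => integral_splitTerm_zd μW r (s : ℂ) x w (hf k hk),
    Finset.sum_congr rfl fun k hk => integral_splitTerm_zd μW r (s : ℂ) x w (hb k hk)] at h
  simp only [integral_plaqTerm_zd] at h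
  have hre := congrArg Complex.re h
  simp only [Complex.re_sum, Complex.add_re, Complex.sub_re, Complex.zero_re, re_ofReal_div_two_mul,
    re_ofReal_div_natCast_mul] at hre
  have h2 := congrArg (fun t : ℝ => 1 / (r.N : ℝ) ^ 2 * t) hre
  simp only [mul_zero, mul_add, mul_sub, Finset.mul_sum] at h2
  convert h2 using 2
  · congr 1
    · exact Finset.sum_congr rfl fun k _ => by ring
    · exact Finset.sum_congr rfl fun k _ => by ring
  · rw [Finset.mul_sum]
    refine Finset.sum_congr rfl fun ν _ => ?_
    rw [Finset.mul_sum]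
    exact Finset.sum_congr rfl fun ε _ => by ring

end PairForm

end TiltedRP

end Summit.QuantumFields.GaugeBoot

end
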